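/-
[OURS · L1 W4.5(b) · EL♮(3)] SPECIMEN-TC⁺ (quartic) — transport of regularity of reduced closed subschemes along local isomorphisms.
-/
import Summits.ResolutionOfSingularities.ResolutionOfSingularities.Theorems.EquisingularLiftEquisingularLiftNatSpecimenQuarticTcDeltaTransport
import Summits.ResolutionOfSingularities.ResolutionOfSingularities.Theorems.EquisingularLiftEquisingularLiftNatSpecimenQuarticTcDeltaEngine
import Literature.AlgebraicGeometry.Resolution.BlowupsLocal
import HarnessLib

/-!
# [OURS · L1 W4.5(b) · EL♮(3)] SPECIMEN-TC⁺ for the quartic — part R: TRANSPORT OF REGULARITY OF REDUCED CLOSED SUBSCHEMES ALONG OPEN IMMERSIONS,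
# ALONG BLOW-UPS THAT ARE ISOMORPHISMS OVER AN OPEN, AND BETWEEN TWO BLOW-UPS OF THE SAME CENTRE
# (crux `EquisingularLiftNatThree` = stmt-ResolutionOfSingularities-20148; res-L1-w45b-lead-2 DEALS (D2) 2026-08-27T11:55:26Z «NON-VACUITY
# CERTIFICATES TC⁺»; scoping memo D/res-D-pv-034/SPECIMEN-TCPLUS-SCOPE.md §5; helper, closes nothing)

HONEST FRAMING. OURS (cell `res-hironaka`, chain w45b, slot W4.5(b)); NOT a statement of any manuscript; AI-written, weaker than expert review.

Generic scheme plumbing for the final regularity clause of the TC⁺ certificate (five blow-ups of `ℙ³`):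
* `comapι K c : V(K · 𝒪_P) → V(K)` for an open immersion `c : P → X` (Mathlib's `comapIso` + `pullback.snd`), an open immersion over `c`;
  `isRegularLocalRing_transport`: if `K · 𝒪_P = K' · 𝒪_P` for two open immersions `c : P → X`, `c' : P → X'`, regularity of `V(K')` over
  `c'(P)` gives regularity of `V(K)` over `c(P)`;
* `isRegularLocalRing_subscheme_of_isIso_restrict`: for `υ : F' → F` an isomorphism over an open `O` and closed `T ⊆ F`, `T' ⊆ F'` with
  `T' ∩ υ⁻¹O = υ⁻¹(T ∩ O)`, regularity of `V(T)_red` over `O` gives regularity of `V(T')_red` over `υ⁻¹O` (one blow-up off its centre);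
* `exists_iso_of_isBlowup_restrict`: if `υᵢ : F₂ → F₁` is an isomorphism over `O` and `υ' : F₃ → F₂` is a blow-up whose centre over `υᵢ⁻¹O` is
  the pull-back of `C|_O`, then over `O` the composite `υ' ≫ υᵢ` is isomorphic to ANY blow-up `μ : M → F₁` of `C` (`IsBlowup.unique`);
* `preimage_ι_closure_preimage_diff{,'}`: the strict-transform sets read on these open pieces.

References: Görtz–Wedhorn I, (13.19), Prop. 13.91; Hartshorne II Prop. 5.9, Ex. 3.2.6; Stacks 01J3, 080E.
-/

set_option linter.dupNamespace false -- mandated namespace `Summit.<Summit>.<Problem>` of this single-conjunct summit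

noncomputable section

open CategoryTheory CategoryTheory.Limits AlgebraicGeometry TopologicalSpace
open AlgebraicGeometry.Scheme.IdealSheafData
open Literature.AlgebraicGeometry.Resolution
open Summit.ResolutionOfSingularities.ResolutionOfSingularities.Theorems.EquisingularLift

namespace Summit.ResolutionOfSingularities.ResolutionOfSingularities.Cruxes.EquisingularLiftNat.Sections

namespace SpecimenQuarticTcPlus

universe u

/-! ## `V(K · 𝒪_P) → V(K)` for an open immersion `c : P → X` -/

section Comapι

variable {P X : Scheme.{u}} (K : X.IdealSheafData) (c : P ⟶ X)

/-- The canonical morphism `V(K · 𝒪_P) ≅ V(K) ×_X P → V(K)`. [folklore] -/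
def comapι : (K.comap c).subscheme ⟶ K.subscheme := (K.comapIso c).hom ≫ pullback.snd c K.subschemeι

/-- `comapι` lies over `c`. [folklore] -/
theorem comapι_subschemeι : comapι K c ≫ K.subschemeι = (K.comap c).subschemeι ≫ c := by
  rw [comapι, Category.assoc, ← pullback.condition, ← Category.assoc, comapIso_hom_fst]

/-- `comapι` lies over `c`, pointwise. [folklore] -/
theorem subschemeι_comapι_apply (z : (K.comap c).subscheme) : K.subschemeι (comapι K c z) = c ((K.comap c).subschemeι z) := by
  rw [← Scheme.Hom.comp_apply, comapι_subschemeι, Scheme.Hom.comp_apply]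

/-- For an open immersion `c`, `comapι` is an open immersion. [folklore] -/
instance isOpenImmersion_comapι [IsOpenImmersion c] : IsOpenImmersion (comapι K c) := by
  unfold comapι; infer_instance

/-- A point of `V(K)` over `c(P)` is in the range of `comapι`. [folklore] -/
theorem mem_range_comapι {z : K.subscheme} (hz : K.subschemeι z ∈ Set.range c) : z ∈ Set.range (comapι K c) := by
  have hz' : z ∈ Set.range (pullback.snd c K.subschemeι) := by
    rw [Scheme.Pullback.range_snd]; exact hz
  obtain ⟨y, hy⟩ := hz'
  refine ⟨(K.comapIso c).inv y, ?_⟩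
  change ((K.comapIso c).inv ≫ (K.comapIso c).hom ≫ pullback.snd c K.subschemeι) y = z
  rw [Iso.inv_hom_id_assoc]
  exact hy

/-- Regularity at a point of `V(K · 𝒪_P)` is regularity of `V(K)` at its image (open immersion). [folklore] -/
theorem isRegularLocalRing_iff_comapι [IsOpenImmersion c] (z : (K.comap c).subscheme) :
    IsRegularLocalRing ((K.comap c).subscheme.presheaf.stalk z) ↔ IsRegularLocalRing (K.subscheme.presheaf.stalk (comapι K c z)) := by
  constructor
  · intro h
    exact IsRegularLocalRing.of_ringEquiv (asIso ((comapι K c).stalkMap z)).commRingCatIsoToRingEquiv.symm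
  · intro h
    exact IsRegularLocalRing.of_ringEquiv (asIso ((comapι K c).stalkMap z)).commRingCatIsoToRingEquiv

end Comapι

/-! ## Transport between two open immersions with the same pulled-back ideal -/

section Transport

variable {P X X' : Scheme.{u}}

/-- From a point of `V(K)` over `c(P)` to a point of `V(I)`, `I = K · 𝒪_P`, with the same regularity (the common ideal is a free
variable so that the identification is by substitution). [folklore] -/
theorem exists_point_comap_of_eq (I : P.IdealSheafData) (c : P ⟶ X) [IsOpenImmersion c] (K : X.IdealSheafData) (hI : K.comap c = I)
    (z : K.subscheme) (hz : K.subschemeι z ∈ Set.range c) :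
    ∃ z₀ : I.subscheme, c (I.subschemeι z₀) = K.subschemeι z ∧
      (IsRegularLocalRing (I.subscheme.presheaf.stalk z₀) ↔ IsRegularLocalRing (K.subscheme.presheaf.stalk z)) := by
  subst hI
  obtain ⟨z₀, rfl⟩ := mem_range_comapι K c hz
  exact ⟨z₀, (subschemeι_comapι_apply K c z₀).symm, isRegularLocalRing_iff_comapι K c z₀⟩

/-- From a point of `V(I)`, `I = K' · 𝒪_P`, to a point of `V(K')` over `c'(P)` with the same regularity. [folklore] -/
theorem exists_point_of_comap_eq (I : P.IdealSheafData) (c' : P ⟶ X') [IsOpenImmersion c'] (K' : X'.IdealSheafData) (hI : K'.comap c' = I)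
    (z₀ : I.subscheme) :
    ∃ z' : K'.subscheme, K'.subschemeι z' = c' (I.subschemeι z₀) ∧
      (IsRegularLocalRing (I.subscheme.presheaf.stalk z₀) ↔ IsRegularLocalRing (K'.subscheme.presheaf.stalk z')) := by
  subst hI
  exact ⟨comapι K' c' z₀, subschemeι_comapι_apply K' c' z₀, isRegularLocalRing_iff_comapι K' c' z₀⟩

/-- **Transport of regularity.** Let `c : P → X`, `c' : P → X'` be open immersions with `K · 𝒪_P = K' · 𝒪_P`. If `V(K')` is regular at every
point over `c'(P)`, then `V(K)` is regular at every point over `c(P)`. [cite: Hartshorne1977, II Prop. 5.9] [folklore] -/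
theorem isRegularLocalRing_transport (c : P ⟶ X) (c' : P ⟶ X') [IsOpenImmersion c] [IsOpenImmersion c']
    (K : X.IdealSheafData) (K' : X'.IdealSheafData) (h : K.comap c = K'.comap c')
    (hreg : ∀ z' : K'.subscheme, K'.subschemeι z' ∈ Set.range c' → IsRegularLocalRing (K'.subscheme.presheaf.stalk z'))
    (z : K.subscheme) (hz : K.subschemeι z ∈ Set.range c) :
    IsRegularLocalRing (K.subscheme.presheaf.stalk z) := by
  obtain ⟨z₀, -, iff₀⟩ := exists_point_comap_of_eq (K.comap c) c K rfl z hz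
  obtain ⟨z', h', iff'⟩ := exists_point_of_comap_eq (K.comap c) c' K' h.symm z₀
  exact iff₀.mp (iff'.mpr (hreg z' (by rw [h']; exact ⟨_, rfl⟩)))

end Transport

/-! ## One blow-up that is an isomorphism over an open -/

section OneStep

variable {F F' : Scheme.{u}} (υ : F' ⟶ F) (O : F.Opens)

/-- The open piece `υ⁻¹O → F`, an open immersion when `υ` is an isomorphism over `O`. [folklore] -/
theorem isOpenImmersion_restrict_comp_ι [IsIso (υ ∣_ O)] : IsOpenImmersion ((υ ∣_ O) ≫ O.ι) := inferInstance

/-- **One blow-up off its centre.** If `υ : F' → F` is an isomorphism over the open `O`, `T ⊆ F` and `T' ⊆ F'` are closed with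
`T' ∩ υ⁻¹O = υ⁻¹T ∩ υ⁻¹O`, and `V(T)_red` is regular at every point over `O`, then `V(T')_red` is regular at every point over `υ⁻¹O`.
[OURS · SPECIMEN-TC⁺ plumbing] [cite: GortzWedhorn2020, Prop. 13.91] -/
theorem isRegularLocalRing_subscheme_of_isIso_restrict [IsIso (υ ∣_ O)] {T : Set F} (hT : IsClosed T) {T' : Set F'} (hT' : IsClosed T')
    (h : T' ∩ υ ⁻¹' (O : Set F) = υ ⁻¹' T ∩ υ ⁻¹' (O : Set F))
    (hreg : ∀ x : (vanishingIdeal (⟨T, hT⟩ : Closeds F)).subscheme,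
      (vanishingIdeal (⟨T, hT⟩ : Closeds F)).subschemeι x ∈ O → IsRegularLocalRing ((vanishingIdeal (⟨T, hT⟩ : Closeds F)).subscheme.presheaf.stalk x))
    (x' : (vanishingIdeal (⟨T', hT'⟩ : Closeds F')).subscheme)
    (hx' : υ ((vanishingIdeal (⟨T', hT'⟩ : Closeds F')).subschemeι x') ∈ O) :
    IsRegularLocalRing ((vanishingIdeal (⟨T', hT'⟩ : Closeds F')).subscheme.presheaf.stalk x') := by
  let d : (↑(υ ⁻¹ᵁ O) : Scheme.{u}) ⟶ F := (υ ∣_ O) ≫ O.ι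
  haveI : IsOpenImmersion d := inferInstance
  have hd : d = (υ ⁻¹ᵁ O).ι ≫ υ := morphismRestrict_ι υ O
  have hK : (vanishingIdeal (⟨T', hT'⟩ : Closeds F')).comap (υ ⁻¹ᵁ O).ι = (vanishingIdeal (⟨T, hT⟩ : Closeds F)).comap d := by
    rw [comap_vanishingIdeal_of_isOpenImmersion, comap_vanishingIdeal_of_isOpenImmersion]
    congr 1
    apply Closeds.ext
    change (υ ⁻¹ᵁ O).ι ⁻¹' T' = d ⁻¹' T
    ext u
    have hu : υ ((υ ⁻¹ᵁ O).ι u) ∈ (O : Set F) := u.2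
    have h1 := Set.ext_iff.mp h ((υ ⁻¹ᵁ O).ι u)
    simp only [Set.mem_inter_iff, Set.mem_preimage] at h1
    rw [Set.mem_preimage, Set.mem_preimage, hd, Scheme.Hom.comp_apply]
    constructor
    · intro hu'
      exact ((h1.mp ⟨hu', hu⟩)).1
    · intro hu'
      exact ((h1.mpr ⟨hu', hu⟩)).1
  refine isRegularLocalRing_transport (υ ⁻¹ᵁ O).ι d _ _ hK (fun z' hz' => hreg z' ?_) x' ?_
  · obtain ⟨u, hu⟩ := hz'
    rw [← hu]
    change ((υ ∣_ O) ≫ O.ι) u ∈ O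
    rw [Scheme.Hom.comp_apply, Scheme.Opens.ι_apply]
    exact ((υ ∣_ O) u).2
  · rw [Scheme.Opens.range_ι]
    exact hx'

end OneStep

/-! ## Two blow-ups of the same centre over an open -/

section BlowupUnique

variable {F₁ F₂ F₃ M : Scheme.{u}}

/-- **Local comparison of blow-ups.** Let `υᵢ : F₂ → F₁` be an isomorphism over the open `O`, `υ' : F₃ → F₂` a blow-up along `C'` whose
restriction over `υᵢ⁻¹O` is the pull-back of `C|_O`, and `μ : M → F₁` any blow-up along `C`. Then over `O` the pieces of `F₃` and `M` are
isomorphic, compatibly with the projections. [cite: GortzWedhorn2020, (13.19) p. 413] -/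
theorem exists_iso_of_isBlowup_restrict (υᵢ : F₂ ⟶ F₁) (O : F₁.Opens) [IsIso (υᵢ ∣_ O)] (υ' : F₃ ⟶ F₂) (C' : F₂.IdealSheafData)
    (hυ' : IsBlowup υ' C') (C : F₁.IdealSheafData) (hC : C'.comap (υᵢ ⁻¹ᵁ O).ι = (C.comap O.ι).comap (υᵢ ∣_ O))
    (μ : M ⟶ F₁) (hμ : IsBlowup μ C) :
    ∃ e : (↑(υ' ⁻¹ᵁ (υᵢ ⁻¹ᵁ O)) : Scheme.{u}) ≅ ↑(μ ⁻¹ᵁ O), e.hom ≫ (μ ∣_ O) = (υ' ∣_ (υᵢ ⁻¹ᵁ O)) ≫ (υᵢ ∣_ O) := by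
  have h1 : IsBlowup ((υ' ∣_ (υᵢ ⁻¹ᵁ O)) ≫ (asIso (υᵢ ∣_ O)).hom) ((C'.comap (υᵢ ⁻¹ᵁ O).ι).comap (asIso (υᵢ ∣_ O)).inv) :=
    (hυ'.restrict _).comp_iso (asIso (υᵢ ∣_ O))
  rw [hC, ← Scheme.IdealSheafData.comap_comp, asIso_inv, IsIso.inv_hom_id, Scheme.IdealSheafData.comap_id] at h1
  obtain ⟨e, he, -⟩ := h1.unique (hμ.restrict O)
  exact ⟨e, he⟩

/-- **Strict-transform sets on the open piece** (two levels): with `T' ∩ υᵢ⁻¹O = υᵢ⁻¹T ∩ υᵢ⁻¹O` and `C' ∩ υᵢ⁻¹O = υᵢ⁻¹C ∩ υᵢ⁻¹O`,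
the trace of `closure υ'⁻¹(T' ∖ C')` on `υ'⁻¹υᵢ⁻¹O` is the closure of the preimage of `T ∖ C`. [folklore] -/
theorem preimage_ι_closure_preimage_diff (υᵢ : F₂ ⟶ F₁) (O : F₁.Opens) (υ' : F₃ ⟶ F₂) {T' C' : Set F₂} {T C : Set F₁}
    (hT : T' ∩ υᵢ ⁻¹' (O : Set F₁) = υᵢ ⁻¹' T ∩ υᵢ ⁻¹' (O : Set F₁))
    (hCC : C' ∩ υᵢ ⁻¹' (O : Set F₁) = υᵢ ⁻¹' C ∩ υᵢ ⁻¹' (O : Set F₁)) :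
    (υ' ⁻¹ᵁ (υᵢ ⁻¹ᵁ O)).ι ⁻¹' closure (υ' ⁻¹' (T' \ C')) =
      closure (((υ' ∣_ (υᵢ ⁻¹ᵁ O)) ≫ (υᵢ ∣_ O)) ⁻¹' (O.ι ⁻¹' (T \ C))) := by
  rw [(υ' ⁻¹ᵁ (υᵢ ⁻¹ᵁ O)).ι.isOpenEmbedding.isOpenMap.preimage_closure_eq_closure_preimage (Scheme.Hom.continuous _)]
  congr 1
  ext u
  have hu : υᵢ (υ' ((υ' ⁻¹ᵁ (υᵢ ⁻¹ᵁ O)).ι u)) ∈ (O : Set F₁) := u.2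
  have h1 := Set.ext_iff.mp hT (υ' ((υ' ⁻¹ᵁ (υᵢ ⁻¹ᵁ O)).ι u))
  have h2 := Set.ext_iff.mp hCC (υ' ((υ' ⁻¹ᵁ (υᵢ ⁻¹ᵁ O)).ι u))
  simp only [Set.mem_inter_iff, Set.mem_preimage] at h1 h2
  have hval : (O.ι (((υ' ∣_ (υᵢ ⁻¹ᵁ O)) ≫ (υᵢ ∣_ O)) u)) = υᵢ (υ' ((υ' ⁻¹ᵁ (υᵢ ⁻¹ᵁ O)).ι u)) := by
    rw [Scheme.Hom.comp_apply, Scheme.Opens.ι_apply, morphismRestrict_base_coe, morphismRestrict_base_coe]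
    rfl
  simp only [Set.mem_preimage, Set.mem_sdiff]
  rw [hval]
  constructor
  · rintro ⟨ha, hb⟩
    exact ⟨(h1.mp ⟨ha, hu⟩).1, fun hc => hb (h2.mpr ⟨hc, hu⟩).1⟩
  · rintro ⟨ha, hb⟩
    exact ⟨(h1.mpr ⟨ha, hu⟩).1, fun hc => hb (h2.mp ⟨hc, hu⟩).1⟩

/-- **Strict-transform sets on the open piece** (one level). [folklore] -/
theorem preimage_ι_closure_preimage_diff' (μ : M ⟶ F₁) (O : F₁.Opens) {T C : Set F₁} :
    (μ ⁻¹ᵁ O).ι ⁻¹' closure (μ ⁻¹' (T \ C)) = closure ((μ ∣_ O) ⁻¹' (O.ι ⁻¹' (T \ C))) := by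
  rw [(μ ⁻¹ᵁ O).ι.isOpenEmbedding.isOpenMap.preimage_closure_eq_closure_preimage (Scheme.Hom.continuous _)]
  congr 1
  ext u
  have hval : (O.ι ((μ ∣_ O) u)) = μ ((μ ⁻¹ᵁ O).ι u) := by
    rw [Scheme.Opens.ι_apply, morphismRestrict_base_coe]
    rfl
  simp only [Set.mem_preimage, Set.mem_sdiff]
  rw [hval]

/-- **Comparison of reduced strict transforms.** In the situation of `exists_iso_of_isBlowup_restrict`, with closed `T₃ ⊆ F₃`, `T_M ⊆ M`
whose traces on the open pieces correspond under `e`, regularity of `V(T_M)_red` over `O` gives regularity of `V(T₃)_red` over `O`.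
[OURS · SPECIMEN-TC⁺ plumbing] [folklore] -/
theorem isRegularLocalRing_subscheme_of_iso_pieces (υᵢ : F₂ ⟶ F₁) (O : F₁.Opens) (υ' : F₃ ⟶ F₂) (μ : M ⟶ F₁)
    (e : (↑(υ' ⁻¹ᵁ (υᵢ ⁻¹ᵁ O)) : Scheme.{u}) ≅ ↑(μ ⁻¹ᵁ O))
    {T₃ : Set F₃} (hT₃ : IsClosed T₃) {T_M : Set M} (hT_M : IsClosed T_M)
    (hset : e.hom ⁻¹' ((μ ⁻¹ᵁ O).ι ⁻¹' T_M) = (υ' ⁻¹ᵁ (υᵢ ⁻¹ᵁ O)).ι ⁻¹' T₃)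
    (hreg : ∀ m : (vanishingIdeal (⟨T_M, hT_M⟩ : Closeds M)).subscheme,
      μ ((vanishingIdeal (⟨T_M, hT_M⟩ : Closeds M)).subschemeι m) ∈ O →
        IsRegularLocalRing ((vanishingIdeal (⟨T_M, hT_M⟩ : Closeds M)).subscheme.presheaf.stalk m))
    (z : (vanishingIdeal (⟨T₃, hT₃⟩ : Closeds F₃)).subscheme)
    (hz : υᵢ (υ' ((vanishingIdeal (⟨T₃, hT₃⟩ : Closeds F₃)).subschemeι z)) ∈ O) :
    IsRegularLocalRing ((vanishingIdeal (⟨T₃, hT₃⟩ : Closeds F₃)).subscheme.presheaf.stalk z) := by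
  let d : (↑(υ' ⁻¹ᵁ (υᵢ ⁻¹ᵁ O)) : Scheme.{u}) ⟶ M := e.hom ≫ (μ ⁻¹ᵁ O).ι
  haveI : IsOpenImmersion d := inferInstance
  have hK : (vanishingIdeal (⟨T₃, hT₃⟩ : Closeds F₃)).comap (υ' ⁻¹ᵁ (υᵢ ⁻¹ᵁ O)).ι = (vanishingIdeal (⟨T_M, hT_M⟩ : Closeds M)).comap d := by
    rw [comap_vanishingIdeal_of_isOpenImmersion, comap_vanishingIdeal_of_isOpenImmersion]
    congr 1
    apply Closeds.ext
    change (υ' ⁻¹ᵁ (υᵢ ⁻¹ᵁ O)).ι ⁻¹' T₃ = d ⁻¹' T_M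
    rw [← hset]
    change _ = (e.hom ≫ (μ ⁻¹ᵁ O).ι) ⁻¹' T_M
    rw [Scheme.Hom.comp_base, TopCat.coe_comp, Set.preimage_comp]
  refine isRegularLocalRing_transport (υ' ⁻¹ᵁ (υᵢ ⁻¹ᵁ O)).ι d _ _ hK (fun m hm => hreg m ?_) z ?_
  · obtain ⟨u, hu⟩ := hm
    rw [← hu]
    change μ ((e.hom ≫ (μ ⁻¹ᵁ O).ι) u) ∈ O
    rw [Scheme.Hom.comp_apply, Scheme.Opens.ι_apply]
    exact (e.hom u).2
  · rw [Scheme.Opens.range_ι]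
    exact hz

end BlowupUnique

end SpecimenQuarticTcPlus

end Summit.ResolutionOfSingularities.ResolutionOfSingularities.Cruxes.EquisingularLiftNat.Sections
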